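import Summits.NavierStokesRegularity.NavierStokesRegularity.Theses.AngularGalerkinLadder
import Summits.NavierStokesRegularity.NavierStokesRegularity.Theorems.NoOverheating.Negative.LadderLimitExposed
import Summits.NavierStokesRegularity.NavierStokesRegularity.Theorems.NoOverheating.Negative.RotatedDSSVorticityDirection
import Summits.NavierStokesRegularity.FluidComputer.AlignedVorticityWeakLimit
import Literature.Analysis.FluidPDE.GigaMiura2011UnidirectionalVorticityHolds
import Literature.Analysis.FluidPDE.AncientMildCurlCompactness
import Literature.Analysis.FluidPDE.CurlFreeLiouville
import HarnessLib

/-!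
# `NoOverheating` window sequences with unidirectional or continuously aligned vorticity are excluded

Negative (kernel) lane of route `AngularGalerkinLadder`, stratum (S9) of the census of excluded
window sequences for the crux `NoOverheating` (K2) — part 2 of 2: the **vorticity-direction
criterion** of Giga–Miura 2011 (Theorem 1.3 / condition (CA) of Constantin–Fefferman type, and the
rigidity Proposition 2.2 behind it), transported onto window sequences of Type-I rotated-DSS rung
profiles.

Along a window sequence whose profiles have unidirectional slice vorticity
`curl u_n(t) = |curl u_n(t)| e_n(t)`, the Type-I ladder limit `v` (`exists_ladderLimit_typeI`:
pointwise limit, ancient mild, Type I, rotated DSS with factor `c' > 1`, amplitude floor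
`‖v(−1, x₀)‖ ≥ δ`) has unidirectional slice vorticity by the weak-limit device
`exists_unidirectional_curl_of_tendsto_of_aligned` (with `ε_j = d_j = 0`); its time translate
`v(· − 1)` is a bounded ancient mild solution with all space derivatives bounded (KNSS (4.10),
`exists_iteratedFDeriv_bound_of_bounded_oseenMild`), so Giga–Miura's Proposition 2.2
(`gigaMiura2011_unidirectional_vorticity_eq_zero_holds`: 2D reduction + KNSS Theorem 5.1) kills its
vorticity; the slice `v(−c'²)` is then curl- and divergence-free and bounded, hence constant
(`eq_of_curl_eq_zero_of_isDivFree_of_bounded`), hence zero by the Type-I spatial decay, and the DSS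
relation `v(−1, x₀) = c'R'ᵀv(−c'², c'R'x₀) = 0` contradicts the floor
(`no_windowSequence_unidirectional`). With part 1 (`unidirectional_of_continuousAlignment`: for an
exactly rotated-DSS profile (CA) self-improves to parallel vorticity): window sequences all of whose
profiles satisfy (CA) on `(−1,0) × ℝ³`, with profile-dependent threshold and modulus, are excluded
(`no_windowSequence_continuousAlignment`; one exact profile: `no_exact_windowProfile_continuousAlignment`),
and the supply form of `NoOverheating` with such windows is incompatible with `RungBlowupCofinal`
(`not_cofinal_and_noOverheating_continuousAlignment`).

What escapes (S9): window sequences whose profiles' vorticity directions vary at the scale of the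
profile on `(−1, 0)` with no modulus at any threshold — for an exactly DSS profile the generic case,
(CA) being equivalent to parallel vorticity by part 1.

No new definitions, no new facts; standard axioms.

References: Y. Giga, H. Miura, *On vorticity directions near singularities for the Navier–Stokes
flows with infinite energy*, Comm. Math. Phys. 303 (2011) 289–300, Theorem 1.3, Remark 1.4 (CA′),
Propositions 2.1–2.2 [GigaMiura2011]; P. Constantin, C. Fefferman, Indiana Univ. Math. J. 42 (1993)
775–789, §1 [ConstantinFefferman1993]; G. Koch, N. Nadirashvili, G. Seregin, V. Šverák, Acta Math.
203 (2009) 83–105, (4.10) and Theorem 5.1 [KNSS2009].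
-/

noncomputable section

namespace Summit.NavierStokesRegularity.AngularGalerkinLadderUnidirectionalVorticityWindowsExcluded

open Set Filter MeasureTheory Topology Function Metric
open scoped RealInnerProductSpace
open Literature.Analysis Literature.Analysis.FluidPDE
open Summit.NavierStokesRegularity.FluidComputer
open Summit.NavierStokesRegularity.NavierStokesRegularity.Theses.AngularGalerkinLadder
open Summit.NavierStokesRegularity.AngularGalerkinLadderLadderLimit
open Summit.NavierStokesRegularity.AngularGalerkinLadderRotatedDSSVorticityDirection

/-! ## §2 The exclusion -/

/-- **NO WINDOW SEQUENCE WITH UNIDIRECTIONAL SLICE VORTICITY.** Let `(u_n, p_n, d_n)` be window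
profiles (`IsWindowProfile`, window `(C₀, [c_min, c_max], δ)`, `c_min > 1`, `δ > 0`, defects
`ε_n → 0`) such that every slice of every profile has unidirectional vorticity,
`curl u_n(t) = |curl u_n(t)| e_n(t)`. Contradiction: the Type-I ladder limit `v` inherits
unidirectional slice vorticity (weak-limit device, `ε_j = d_j = 0`), its translate `v(· − 1)` is a
bounded ancient mild solution with bounded derivatives of all orders (KNSS (4.10)), so by
Giga–Miura's Proposition 2.2 `curl v ≡ 0` on `t < −1`; the slice `v(−c'²)` is then constant
(harmonic Liouville), zero (Type-I spatial decay), and `v(−1, x₀) = c'R'ᵀ v(−c'², c'R'x₀) = 0`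
contradicts `‖v(−1, x₀)‖ ≥ δ`. [cite: GigaMiura2011, Prop. 2.2, proof (§2.1; HUPS preprint #956 pp. 7–8)] -/
theorem no_windowSequence_unidirectional {C₀ cmin cmax δ : ℝ} {L : ℕ → ℕ} {ε c : ℕ → ℝ}
    {R : ℕ → (EuclideanSpace ℝ (Fin 3) ≃ₗᵢ[ℝ] EuclideanSpace ℝ (Fin 3))}
    {u : ℕ → ℝ → EuclideanSpace ℝ (Fin 3) → EuclideanSpace ℝ (Fin 3)}
    {p : ℕ → ℝ → EuclideanSpace ℝ (Fin 3) → ℝ}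
    {d : ℕ → ℝ → EuclideanSpace ℝ (Fin 3) → EuclideanSpace ℝ (Fin 3)}
    (hcmin : 1 < cmin) (hδ : 0 < δ) (hε : Tendsto ε atTop (𝓝 0))
    (hW : ∀ n, AngularLadder.IsWindowProfile (L n) C₀ cmin cmax δ (ε n) (c n) (R n) (u n) (p n)
      (d n))
    (hdir : ∀ n, ∀ t < 0, ∃ e : EuclideanSpace ℝ (Fin 3), ∀ x,
      curl (u n t) x = ‖curl (u n t) x‖ • e) : False := by
  obtain ⟨φ, c', R', v, -, -, -, -, hptw, -, -, hc', hTAM, -, hDSS, hvTI, hamp, -⟩ :=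
    exists_ladderLimit_typeI hcmin hδ hε hW
  have hC₀ : 0 ≤ C₀ := hTAM.nonneg
  -- Step 1: every slice of the limit has unidirectional vorticity
  have hζ : ∀ t : ℝ, ∃ ζ : EuclideanSpace ℝ (Fin 3), t < 0 → ∀ x,
      curl (v t) x = ‖curl (v t) x‖ • ζ := by
    intro t
    by_cases ht : t < 0
    swap
    · exact ⟨0, fun h => absurd h ht⟩
    have hsq : 0 < Real.sqrt (-t) := Real.sqrt_pos.2 (by linarith)
    have hw : ∀ᶠ j in atTop, ContDiff ℝ 1 (u (φ j) t) := Eventually.of_forall fun j =>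
      ((hW (φ j)).1.classical.smooth_velocity.contDiff_slice (mem_Iio.2 ht)).of_le
        (by exact_mod_cast le_top)
    have hV : ContDiff ℝ 1 (v t) := (hTAM.contDiff_slice ht).of_le (by exact_mod_cast le_top)
    have hK : ∀ᶠ j in atTop, ∀ y, ‖u (φ j) t y‖ ≤ C₀ / Real.sqrt (-t) :=
      Eventually.of_forall fun j y =>
        ((hW (φ j)).1.hasTypeIDecay t ht y).trans
          (div_le_div_of_nonneg_left hC₀ hsq (by linarith [norm_nonneg y]))
    obtain ⟨ζ, hζ⟩ := exists_unidirectional_curl_of_tendsto_of_aligned (w := fun j => u (φ j) t)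
      hw hV (div_nonneg hC₀ hsq.le) hK (hptw t ht) fun _ =>
        ⟨fun _ => 0, fun _ => 0, tendsto_const_nhds, tendsto_const_nhds, fun _ => le_rfl,
          fun _ => le_rfl, Eventually.of_forall fun j y _ y' _ hy hy' => by
            obtain ⟨e, he⟩ := hdir (φ j) t ht
            have hy0 : curl (u (φ j) t) y ≠ 0 := norm_pos_iff.1 hy
            have hy0' : curl (u (φ j) t) y' ≠ 0 := norm_pos_iff.1 hy'
            rw [vorticityDirection_eq_of_eq_norm_smul he hy0,
              vorticityDirection_eq_of_eq_norm_smul he hy0', sub_self, norm_zero]⟩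
    exact ⟨ζ, fun _ => hζ⟩
  choose ζ hζ using hζ
  -- Step 2: the translate `w = v(· − 1)` is in Giga–Miura's class, so `curl w ≡ 0`
  have hTAMw : IsTypeIAncientMild C₀ (fun t => v (t - 1)) := hTAM.comp_sub_right zero_le_one
  have hBw : ∀ t < 0, ∀ x, ‖v (t - 1) x‖ ≤ C₀ := by
    intro t ht x
    refine (hTAM.norm_le (t := t - 1) (by linarith) x).trans (div_le_self hC₀ ?_)
    exact Real.one_le_sqrt.2 (by linarith)
  have hbd : ∀ k : ℕ, ∃ C : ℝ, ∀ t < 0, ∀ x,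
      ‖iteratedFDeriv ℝ k ((fun t => v (t - 1)) t) x‖ ≤ C := by
    intro k
    obtain ⟨K, hK⟩ := exists_iteratedFDeriv_bound_of_bounded_oseenMild C₀ k
    refine ⟨K, fun t ht x => ?_⟩
    refine (hK (A := t - 2) (u := fun τ => v (τ - 1))
      (hTAMw.continuousOn_uncurry.mono (prod_mono Ioo_subset_Iio_self Subset.rfl))
      (fun τ hτ => hTAMw.isWeaklyDivFree hτ.2)
      (fun s τ _ hsτ hτ y => hTAMw.mild_eq_heatExtension hsτ hτ y)
      (fun τ hτ y => hBw τ hτ.2 y) t (by linarith) ht).2 x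
  have hcurl0 : ∀ t < 0, ∀ x, curl ((fun t => v (t - 1)) t) x = 0 :=
    gigaMiura2011_unidirectional_vorticity_eq_zero_holds hTAMw.contDiffOn hbd
      (fun t ht => hTAMw.isWeaklyDivFree ht) (fun s t hst ht x => hTAMw.mild_eq_heatExtension hst ht x)
      ⟨fun t => ζ (t - 1), fun t ht x => hζ (t - 1) (by linarith) x⟩
  -- Step 3: the slice `v(−c'²)` vanishes
  set s₀ : ℝ := -(c' ^ 2) with hs₀def
  have hc'2 : 1 < c' ^ 2 := by nlinarith
  have hs₀ : s₀ < 0 := by rw [hs₀def]; linarith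
  have hcurl : ∀ x, curl (v s₀) x = 0 := by
    intro x
    have h1 := hcurl0 (1 - c' ^ 2) (by linarith) x
    simp only at h1
    rwa [show (1 : ℝ) - c' ^ 2 - 1 = s₀ by rw [hs₀def]; ring] at h1
  have hconst : ∀ x, v s₀ x = v s₀ 0 := fun x =>
    eq_of_curl_eq_zero_of_isDivFree_of_bounded ((hTAM.contDiff_slice hs₀).of_le (by norm_cast))
      hcurl (hTAM.isDivFree hs₀) (fun y => hTAM.norm_le hs₀ y) x 0
  have hzero : v s₀ 0 = 0 := by
    -- `‖v(s₀, 0)‖ = ‖v(s₀, x)‖ ≤ C₀/(‖x‖ + √(−s₀)) ≤ C₀/‖x‖`, small for `‖x‖` large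
    by_contra hne
    have ha : 0 < ‖v s₀ 0‖ := norm_pos_iff.2 hne
    obtain ⟨x, hx⟩ := NormedSpace.exists_lt_norm ℝ (EuclideanSpace ℝ (Fin 3)) (C₀ / ‖v s₀ 0‖)
    have hxpos : 0 < ‖x‖ := lt_of_le_of_lt (by positivity) hx
    have h1 := hvTI s₀ hs₀ x
    rw [hconst x] at h1
    have h2 : C₀ / (‖x‖ + Real.sqrt (-s₀)) ≤ C₀ / ‖x‖ :=
      div_le_div_of_nonneg_left hC₀ hxpos (le_add_of_nonneg_right (Real.sqrt_nonneg _))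
    rw [div_lt_iff₀ ha] at hx
    have h3 : C₀ / ‖x‖ < ‖v s₀ 0‖ := by rw [div_lt_iff₀ hxpos]; linarith
    linarith
  -- Step 4: the DSS relation transports the zero slice to `t = −1`, contradicting the floor
  obtain ⟨x₀, hx₀⟩ := hamp
  have h1 := hDSS (-1) x₀
  rw [mul_neg_one, ← hs₀def, hconst, hzero, map_zero, smul_zero] at h1
  rw [← h1, norm_zero] at hx₀
  exact absurd hx₀ (not_le.2 hδ)

/-- **NO WINDOW SEQUENCE WHOSE PROFILES SATISFY GIGA–MIURA'S CONTINUOUS ALIGNMENT (CA).** If every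
profile `u_n` of a window sequence has, on the window `(−1, 0) × ℝ³` and above some threshold `d_n`,
vorticity directions with a modulus `η_n` (`η_n(r) → 0` as `r ↓ 0`; both may depend on `n`), the
sequence cannot exist: by the exact rotated-DSS symmetry of each profile (CA) self-improves to
unidirectional slice vorticity (`unidirectional_of_continuousAlignment`), excluded by
`no_windowSequence_unidirectional`. This is the ladder form of Giga–Miura 2011, Theorem 1.3 (no
Type-I blow-up under (CA)). [cite: GigaMiura2011, Theorem 1.3 and Remark 1.4 (§1; HUPS preprint #956 p. 4)] -/
theorem no_windowSequence_continuousAlignment {C₀ cmin cmax δ : ℝ} {L : ℕ → ℕ} {ε c : ℕ → ℝ}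
    {R : ℕ → (EuclideanSpace ℝ (Fin 3) ≃ₗᵢ[ℝ] EuclideanSpace ℝ (Fin 3))}
    {u : ℕ → ℝ → EuclideanSpace ℝ (Fin 3) → EuclideanSpace ℝ (Fin 3)}
    {p : ℕ → ℝ → EuclideanSpace ℝ (Fin 3) → ℝ}
    {d : ℕ → ℝ → EuclideanSpace ℝ (Fin 3) → EuclideanSpace ℝ (Fin 3)}
    (hcmin : 1 < cmin) (hδ : 0 < δ) (hε : Tendsto ε atTop (𝓝 0))
    (hW : ∀ n, AngularLadder.IsWindowProfile (L n) C₀ cmin cmax δ (ε n) (c n) (R n) (u n) (p n)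
      (d n))
    (hCA : ∀ n, ∃ (d₀ : ℝ) (η : ℝ → ℝ), Tendsto η (𝓝[>] 0) (𝓝 0) ∧
      ∀ s ∈ Ioo (-1 : ℝ) 0, ∀ x y, d₀ < ‖curl (u n s) x‖ → d₀ < ‖curl (u n s) y‖ →
        ‖vorticityDirection (curl (u n s)) x - vorticityDirection (curl (u n s)) y‖ ≤ η ‖x - y‖) :
    False := by
  refine no_windowSequence_unidirectional hcmin hδ hε hW fun n => ?_
  obtain ⟨d₀, η, hη, hCAn⟩ := hCA n
  exact unidirectional_of_continuousAlignment (hW n).1.isRotatedDSS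
    (lt_of_lt_of_le hcmin (hW n).2.1) hη hCAn

/-- **An exact (defect-free) window profile cannot satisfy (CA)**: a Type-I rotated-DSS ancient
rung profile with zero Galerkin defect in a window, whose vorticity directions on `(−1,0) × ℝ³`
obey Giga–Miura's (CA) above some threshold, does not exist (constant sequence in
`no_windowSequence_continuousAlignment`). [cite: GigaMiura2011, Theorem 1.3 and Remark 1.4 (§1; HUPS preprint #956 p. 4)] -/
theorem no_exact_windowProfile_continuousAlignment {C₀ cmin cmax δ c : ℝ} {L : ℕ}
    {R : EuclideanSpace ℝ (Fin 3) ≃ₗᵢ[ℝ] EuclideanSpace ℝ (Fin 3)}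
    {u : ℝ → EuclideanSpace ℝ (Fin 3) → EuclideanSpace ℝ (Fin 3)}
    {p : ℝ → EuclideanSpace ℝ (Fin 3) → ℝ}
    {d : ℝ → EuclideanSpace ℝ (Fin 3) → EuclideanSpace ℝ (Fin 3)}
    (hcmin : 1 < cmin) (hδ : 0 < δ)
    (hW : AngularLadder.IsWindowProfile L C₀ cmin cmax δ 0 c R u p d) {d₀ : ℝ} {η : ℝ → ℝ}
    (hη : Tendsto η (𝓝[>] 0) (𝓝 0))
    (hCA : ∀ s ∈ Ioo (-1 : ℝ) 0, ∀ x y, d₀ < ‖curl (u s) x‖ → d₀ < ‖curl (u s) y‖ →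
      ‖vorticityDirection (curl (u s)) x - vorticityDirection (curl (u s)) y‖ ≤ η ‖x - y‖) :
    False :=
  no_windowSequence_continuousAlignment (L := fun _ => L) (ε := fun _ => 0) (c := fun _ => c)
    (R := fun _ => R) (u := fun _ => u) (p := fun _ => p) (d := fun _ => d) hcmin hδ
    tendsto_const_nhds (fun _ => hW) fun _ => ⟨d₀, η, hη, hCA⟩

/-- **Supply form.** `RungBlowupCofinal` together with a `NoOverheating` supply whose window
profiles all satisfy Giga–Miura's (CA) on `(−1, 0) × ℝ³` (threshold and modulus depending on the
rung) is contradictory. [cite: GigaMiura2011, Theorem 1.3 and Remark 1.4 (§1; HUPS preprint #956 p. 4)] -/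
theorem not_cofinal_and_noOverheating_continuousAlignment (C₀ : ℝ) :
    ¬ (RungBlowupCofinal ∧
      ∃ (cmin cmax δ : ℝ) (L₀ : ℕ) (ε : ℕ → ℝ), 1 < cmin ∧ 0 < δ ∧ Tendsto ε atTop (𝓝 0) ∧
        ∀ L ≥ L₀, AngularLadder.RungIsSingular L →
          ∃ (c : ℝ) (R : EuclideanSpace ℝ (Fin 3) ≃ₗᵢ[ℝ] EuclideanSpace ℝ (Fin 3))
            (u : ℝ → EuclideanSpace ℝ (Fin 3) → EuclideanSpace ℝ (Fin 3))
            (p : ℝ → EuclideanSpace ℝ (Fin 3) → ℝ)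
            (d : ℝ → EuclideanSpace ℝ (Fin 3) → EuclideanSpace ℝ (Fin 3)),
            AngularLadder.IsWindowProfile L C₀ cmin cmax δ (ε L) c R u p d ∧
              ∃ (d₀ : ℝ) (η : ℝ → ℝ), Tendsto η (𝓝[>] 0) (𝓝 0) ∧
                ∀ s ∈ Ioo (-1 : ℝ) 0, ∀ x y, d₀ < ‖curl (u s) x‖ → d₀ < ‖curl (u s) y‖ →
                  ‖vorticityDirection (curl (u s)) x - vorticityDirection (curl (u s)) y‖ ≤
                    η ‖x - y‖) := by
  rintro ⟨h₁, cmin, cmax, δ, L₀, ε, hcmin, hδ, hε, hwin⟩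
  choose L hLge hLsing using fun n : ℕ => h₁ (max L₀ n)
  choose c R u p d hW hCA using fun n : ℕ =>
    hwin (L n) (le_trans (le_max_left _ _) (hLge n)) (hLsing n)
  have hε' : Tendsto (fun n : ℕ => ε (L n)) atTop (𝓝 0) :=
    hε.comp (tendsto_atTop_mono (fun n => le_trans (le_max_right _ _) (hLge n)) tendsto_id)
  exact no_windowSequence_continuousAlignment hcmin hδ hε' hW hCA

/-- `RungBlowupCofinal` fails as soon as `NoOverheating` is met by (CA) windows (contrapositive
packaging of `not_cofinal_and_noOverheating_continuousAlignment`). [cite: GigaMiura2011, Theorem 1.3 and Remark 1.4 (§1; HUPS preprint #956 p. 4)] -/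
theorem rungBlowupCofinal_false_of_noOverheating_continuousAlignment (C₀ : ℝ)
    (h : ∃ (cmin cmax δ : ℝ) (L₀ : ℕ) (ε : ℕ → ℝ), 1 < cmin ∧ 0 < δ ∧ Tendsto ε atTop (𝓝 0) ∧
        ∀ L ≥ L₀, AngularLadder.RungIsSingular L →
          ∃ (c : ℝ) (R : EuclideanSpace ℝ (Fin 3) ≃ₗᵢ[ℝ] EuclideanSpace ℝ (Fin 3))
            (u : ℝ → EuclideanSpace ℝ (Fin 3) → EuclideanSpace ℝ (Fin 3))
            (p : ℝ → EuclideanSpace ℝ (Fin 3) → ℝ)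
            (d : ℝ → EuclideanSpace ℝ (Fin 3) → EuclideanSpace ℝ (Fin 3)),
            AngularLadder.IsWindowProfile L C₀ cmin cmax δ (ε L) c R u p d ∧
              ∃ (d₀ : ℝ) (η : ℝ → ℝ), Tendsto η (𝓝[>] 0) (𝓝 0) ∧
                ∀ s ∈ Ioo (-1 : ℝ) 0, ∀ x y, d₀ < ‖curl (u s) x‖ → d₀ < ‖curl (u s) y‖ →
                  ‖vorticityDirection (curl (u s)) x - vorticityDirection (curl (u s)) y‖ ≤
                    η ‖x - y‖) :
    ¬ RungBlowupCofinal := fun h₁ => not_cofinal_and_noOverheating_continuousAlignment C₀ ⟨h₁, h⟩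

end Summit.NavierStokesRegularity.AngularGalerkinLadderUnidirectionalVorticityWindowsExcluded
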